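import Literature.AlgebraicGeometry.Resolution.StrictTransformIsBlowup
import Literature.AlgebraicGeometry.Resolution.AlterationsNormalFormStrictTransform
import Literature.AlgebraicGeometry.Resolution.BlowupsIntegral
import Literature.AlgebraicGeometry.Resolution.ComponentGluing
import Mathlib.AlgebraicGeometry.Morphisms.ClosedImmersion
import Mathlib.AlgebraicGeometry.Morphisms.Proper
import Mathlib.AlgebraicGeometry.IdealSheaf.Functorial
import HarnessLib

/-!
# `EquisingularLift`, line `strata-split` — the reduced strict transform of an irreducible closed set is a blow-up

Crux `stmt-ResolutionOfSingularities-15660` = `Theses.EquisingularLift.EquisingularLift`; helper sub-goal of the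
registered stub `stub_resolveOnePoint_dimOne`. The line encodes chains of blow-ups with strict transforms as SETS:
after blowing up `X` along the ideal sheaf `C` (`τ : X' → X`, `IsBlowup τ C`), the strict transform of a closed
irreducible `S ⊄ V(C)` is the closed set `closure τ⁻¹(S ∖ V(C))`, carried with its REDUCED closed subscheme
structure `(vanishingIdeal ⟨closure τ⁻¹(S ∖ V(C)), _⟩).subscheme` (Mathlib). This file proves that this reduced
strict transform maps to the reduced `Z := V(S)_red` by a proper morphism `ρ` over `τ` which is a BLOW-UP of `Z`
along the restricted centre `C·𝒪_Z = C.comap ι_S` (Stacks, Tag 080E (1); Görtz–Wedhorn I, Prop. 13.91, 13.96 (2)).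

Proof. `Z` is integral (`S` irreducible). The scheme-theoretic strict transform `Z' ⊆ Z ×_X X'`
(`blowupStrictTransform ι_S τ C`, Stacks 080D) with its projection `Z' → Z` IS a blow-up of `Z` along `C.comap ι_S`
(`isBlowup_blowupStrictTransform`, Stacks 080E (1)); a blow-up of an integral scheme is reduced
(`IsBlowup.isReduced`); `Z' → Z ×_X X' → X'` is a closed immersion (composite of closed immersions) whose image is
`closure τ⁻¹(S ∖ V(C))` (`IsBlowup.range_eq_strictTransformSet`); and a closed immersion from a reduced scheme is
isomorphic, over `X'`, to the reduced closed subscheme on its image (`ker_eq_vanishingIdeal_range`,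
`IsClosedImmersion.isIso_lift`). Transport `IsBlowup` along that isomorphism (`IsBlowup.iso_comp`); properness of `ρ`
from `ρ ≫ ι_S = ι' ≫ τ` (closed immersion ≫ proper) and separatedness of `ι_S`.
-/

set_option linter.dupNamespace false -- mandated namespace `Summit.<Summit>.<Problem>` of this single-conjunct summit

noncomputable section

open CategoryTheory CategoryTheory.Limits AlgebraicGeometry TopologicalSpace Topology
open Literature.AlgebraicGeometry.Resolution

namespace Summit.ResolutionOfSingularities.ResolutionOfSingularities.Cruxes.EquisingularLift.StrataSplit

/-- **The reduced strict transform is the blow-up of `V(S)_red` along the restricted centre** (Stacks, Tag 080E (1),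
for the closed immersion `V(S)_red ↪ X`; Görtz–Wedhorn I, Prop. 13.96 (2)). For a blow-up `τ : X' → X` of `X` along
`C` and a closed irreducible `S ⊄ V(C)`, there is a morphism `ρ` from the reduced closed subscheme of `X'` on
`closure τ⁻¹(S ∖ V(C))` to the reduced closed subscheme `Z` of `X` on `S`, over `τ`, which is proper and is a
blow-up of `Z` along `C.comap ι_S`. [cite: StacksProject, Tag 080E] -/
theorem exists_isBlowup_reducedStrictTransform : ∀ (X X' : AlgebraicGeometry.Scheme.{0}) [AlgebraicGeometry.IsLocallyNoetherian X] [AlgebraicGeometry.IsLocallyNoetherian X'] (τ : X' ⟶ X) (C : X.IdealSheafData), Literature.AlgebraicGeometry.Resolution.IsBlowup τ C → ∀ [AlgebraicGeometry.IsProper τ] (S : Set X) (hS : IsClosed S), IsIrreducible S → ¬ S ⊆ (C.support : Set X) → ∃ ρ : (AlgebraicGeometry.Scheme.IdealSheafData.vanishingIdeal (⟨closure (τ ⁻¹' (S \ (C.support : Set X))), isClosed_closure⟩ : TopologicalSpace.Closeds X')).subscheme ⟶ (AlgebraicGeometry.Scheme.IdealSheafData.vanishingIdeal (⟨S, hS⟩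 : TopologicalSpace.Closeds X)).subscheme, CategoryTheory.CategoryStruct.comp ρ (AlgebraicGeometry.Scheme.IdealSheafData.vanishingIdeal (⟨S, hS⟩ : TopologicalSpace.Closeds X)).subschemeι = CategoryTheory.CategoryStruct.comp (AlgebraicGeometry.Scheme.IdealSheafData.vanishingIdeal (⟨closure (τ ⁻¹' (S \ (C.support : Set X))), isClosed_closure⟩ : TopologicalSpace.Closeds X')).subschemeι τ ∧ AlgebraicGeometry.IsProper ρ ∧ Literature.AlgebraicGeometry.Resolution.IsBlowup ρ (C.comap (AlgebraicGeometry.Scheme.IdealSheafData.vanishingIdeal (⟨S, hS⟩ : TopologicalSpace.Closeds X)).subschemeι) := by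
  intro X X' _ _ τ C hτ _ S hS hirr _
  -- the reduced closed subscheme `Z = V(S)_red ↪ X`, integral since `S` is irreducible
  let Z : Scheme.{0} := (Scheme.IdealSheafData.vanishingIdeal (⟨S, hS⟩ : Closeds X)).subscheme
  let ιS : Z ⟶ X := (Scheme.IdealSheafData.vanishingIdeal (⟨S, hS⟩ : Closeds X)).subschemeι
  haveI : IsIntegral Z := ComponentGluing.isIntegral_subscheme_vanishingIdeal ⟨S, hS⟩ hirr
  have hrangeS : Set.range ιS = S := by
    rw [Scheme.IdealSheafData.range_subschemeι, Scheme.IdealSheafData.coe_support_vanishingIdeal]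
    rfl
  -- the scheme-theoretic strict transform `Z' ⊆ Z ×_X X'` (Stacks 080D) and its projection `b' : Z' → Z`,
  -- a blow-up of `Z` along `C.comap ιS` (Stacks 080E (1))
  let ι' : blowupStrictTransform ιS τ C ⟶ pullback ιS τ := blowupStrictTransformι ιS τ C
  let b' : blowupStrictTransform ιS τ C ⟶ Z := ι' ≫ pullback.fst ιS τ
  have hb' : IsBlowup b' (C.comap ιS) := isBlowup_blowupStrictTransform ιS τ C hτ
  -- the closed immersion `j : Z' → Z ×_X X' → X'`, over `ιS`
  let j : blowupStrictTransform ιS τ C ⟶ X' := ι' ≫ pullback.snd ιS τ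
  haveI : IsClosedImmersion j := inferInstance
  have hj : j ≫ τ = b' ≫ ιS := by
    simp only [j, b', Category.assoc, pullback.condition]
  -- `Z'` is reduced (a blow-up of the integral `Z`)
  haveI : IsReduced (blowupStrictTransform ιS τ C) := hb'.isReduced
  -- the image of `j` is the strict transform `closure τ⁻¹(S ∖ V(C))` of the closed set `S`
  have hrange : Set.range j = closure (τ ⁻¹' (S \ (C.support : Set X))) := by
    rw [hτ.range_eq_strictTransformSet hb' hj j.isClosedEmbedding.isClosed_range, hrangeS]
    rfl
  -- so `j` has the same kernel as the reduced closed subscheme `T` of `X'` on that closed set: `Z' ≅ T` over `X'`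
  have hker : (Scheme.IdealSheafData.vanishingIdeal
      (⟨closure (τ ⁻¹' (S \ (C.support : Set X))), isClosed_closure⟩ : Closeds X')).subschemeι.ker = j.ker := by
    rw [Scheme.IdealSheafData.ker_subschemeι, ker_eq_vanishingIdeal_range j j.isClosedEmbedding.isClosed_range]
    congr 1
    exact Closeds.ext hrange.symm
  let e : blowupStrictTransform ιS τ C ⟶ (Scheme.IdealSheafData.vanishingIdeal
      (⟨closure (τ ⁻¹' (S \ (C.support : Set X))), isClosed_closure⟩ : Closeds X')).subscheme :=
    IsClosedImmersion.lift _ j hker.le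
  haveI : IsIso e := IsClosedImmersion.isIso_lift _ j hker
  have he : e ≫ (Scheme.IdealSheafData.vanishingIdeal
      (⟨closure (τ ⁻¹' (S \ (C.support : Set X))), isClosed_closure⟩ : Closeds X')).subschemeι = j :=
    IsClosedImmersion.lift_fac _ j hker.le
  have he' : inv e ≫ j = (Scheme.IdealSheafData.vanishingIdeal
      (⟨closure (τ ⁻¹' (S \ (C.support : Set X))), isClosed_closure⟩ : Closeds X')).subschemeι := by
    rw [← he, IsIso.inv_hom_id_assoc]
  refine ⟨inv e ≫ b', ?_, ?_, ?_⟩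
  · -- `ρ` lies over `τ`
    show (inv e ≫ b') ≫ ιS = _ ≫ τ
    rw [Category.assoc, ← hj, ← Category.assoc, he']
  · -- `ρ` is proper: `ρ ≫ ιS = ι_T ≫ τ` is proper and `ιS` is separated
    have hc : IsProper ((inv e ≫ b') ≫ ιS) := by
      rw [Category.assoc, ← hj, ← Category.assoc, he']
      infer_instance
    exact MorphismProperty.of_postcomp (W := @AlgebraicGeometry.IsProper)
      (W' := @AlgebraicGeometry.IsSeparated) (inv e ≫ b') ιS inferInstance hc
  · -- `ρ` is a blow-up of `Z` along `C.comap ιS`, transported from `b'` along `Z' ≅ T`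
    exact hb'.iso_comp (asIso e).symm

end Summit.ResolutionOfSingularities.ResolutionOfSingularities.Cruxes.EquisingularLift.StrataSplit

end
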